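import Summits.QuantumAdvantage.QuantumAdvantage.Theorems.CubicForrelationNearExactIsExactTwoModSixTypeO
import Summits.QuantumAdvantage.QuantumAdvantage.Theorems.CubicForrelationNearExactIsExactTwoModSixLevel
import Summits.QuantumAdvantage.QuantumAdvantage.Theorems.CubicForrelationNearExactIsExactFourteenBoundary

/-!
# Crux `CubicForrelation.NearExactIsExact` (stmt-QuantumAdvantage-14043) — for EVERY `n ≡ 2 (mod 6)`, `n ≥ 14`, the boundary value
  `1 − 2^{−⌊n/3⌋−1}` of the uniform one-sided rate is NOT attained: `θ_n < 1 − 2^{−⌊n/3⌋−1}`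

Certificate seat `b2b-cforr-cert` (gen 6).  HONEST FRAMING: a theorem uniform in `n` over the residue class `n ≡ 2 (mod 6)` — infinitely many
finite-slice verdicts at once (it contains the landed `isolation_fourteen_closed` and `isolation_twenty_closed` as the cases `n = 14, 20`);
NOT summit progress: the improved constants still tend to `1`, and the crux asks for ONE `θ < 1` for all `n`.

`tmb_isolation_ge`: for `r ≥ 2` and cubic `f, g : 𝔽₂^{(3r+1)+(3r+1)} → 𝔽₂`: `Φ(f,g) ≥ 1 − 2^{−(2r+1)} ⇒ Φ(f,g) = 1`.  With `W_g = 2^{2r+1}u` (Ax)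
the level parity is constant (tower); type O is excluded by `tmo_typeO_lt` (the residual `u − 2^r(−1)^f` is `±1` everywhere and quadratic of
rank `≤ 2` by the general flat sums — engine `fl1_flat_l1` on the whole space — against the pairing `2^{8r+2}`), and `W_g ∈ 2^{2r+2}ℤ` forces
exactness by `tml_level_ge` (codimension-2 flat + engine, or the tower above).  Corollaries: `isolation_rate_closed_two_mod_six` (at the
literal type `Fin n`, in the shape of `isolation_rate_even` with `≤` in place of `<`), `theta_lt_rate_two_mod_six`.

References: as in the imported files (Ax/McEliece, MacWilliams–Sloane Ch. 13–15, Hou 1998, O'Donnell 2014 §3.3, Aaronson–Ambainis 2018 §1.1.1).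
Everything below is proved from Mathlib and the tree; axioms are the standard three.
-/

set_option linter.dupNamespace false -- D-0017: single-problem summit ⇒ `QuantumAdvantage.QuantumAdvantage` by design

noncomputable section

namespace Summit.QuantumAdvantage.QuantumAdvantage.Theorems.CubicForrelation.NearExactIsExact

open Finset
open Literature.Computability.QuantumComplexity
open Literature.Computability.QuantumComplexity.DerivativeWalsh (W)

/-- **`Φ ≥ 1 − 2^{−(2r+1)} ⇒ Φ = 1` for cubic pairs on `(3r+1) + (3r+1)` bits, every `r ≥ 2`** (the assembly described in the header).
[this work] -/
theorem tmb_isolation_ge (r : ℕ) (hr : 2 ≤ r) (f g : (Fin ((3 * r + 1) + (3 * r + 1)) → Bool) → Bool) (hf : IsDegLeFun 3 f)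
    (hg : IsDegLeFun 3 g) (hΦ : 1 - (1 / 2 : ℝ) ^ (2 * r + 1) ≤ forrelation f g) : forrelation f g = 1 := by
  obtain ⟨u, hu⟩ := tw_base g hg (2 * r + 1) (by omega)
  by_cases hodd : ∃ x, Odd (u x)
  · -- type O (the parity is constant)
    obtain ⟨x₀, hx₀⟩ := hodd
    have hdeg := stub_walshTower stub_axParity ((3 * r + 1) + (3 * r + 1)) (2 * r + 1) 0 g u hg hu (by intro k hk hkn; omega)
    have hall : ∀ x, Odd (u x) := by
      intro x
      have hc := tc_const_of_deg_zero hdeg x x₀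
      rw [decide_eq_true hx₀] at hc
      exact of_decide_eq_true hc
    exact absurd hΦ (not_le.2 (tmo_typeO_lt r (by omega) f g hf hg u hu hall))
  · push Not at hodd
    have hu' := tw_level_up g u hu hodd
    exact tml_level_ge r hr f g hf hg _ hu' hΦ

/-- **For every `n ≡ 2 (mod 6)`, `n ≥ 14`, and all cubic `f, g : 𝔽₂ⁿ → 𝔽₂: `Φ(f,g) ≥ 1 − 2^{−(⌊n/3⌋+1)} ⇒ Φ(f,g) = 1`** — the boundary
value of the uniform rate `isolation_rate_even` is never attained on this residue class (at the literal type `Fin n`).  Infinitely many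
finite-slice verdicts; NOT summit progress. [this work] -/
theorem isolation_rate_closed_two_mod_six : ∀ n : ℕ, n % 6 = 2 → 14 ≤ n → ∀ f g : (Fin n → Bool) → Bool,
    IsDegLeFun 3 f → IsDegLeFun 3 g → 1 - (1 / 2 : ℝ) ^ (n / 3 + 1) ≤ forrelation f g → forrelation f g = 1 := by
  intro n hn h14 f g hf hg hΦ
  obtain ⟨r, hr⟩ : ∃ r, n = (3 * r + 1) + (3 * r + 1) := ⟨n / 6, by omega⟩
  subst hr
  have e : ((3 * r + 1) + (3 * r + 1)) / 3 + 1 = 2 * r + 1 := by omega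
  rw [e] at hΦ
  exact tmb_isolation_ge r (by omega) f g hf hg hΦ

/-- **`θ_n < 1 − 2^{−(⌊n/3⌋+1)}` for every `n ≡ 2 (mod 6)`, `n ≥ 14`:** some constant strictly below the uniform rate already isolates
exactness for cubic pairs on `n` bits (the largest non-exact forrelation value, by finiteness).  NOT summit progress. [this work] -/
theorem theta_lt_rate_two_mod_six (n : ℕ) (hn : n % 6 = 2) (h14 : 14 ≤ n) :
    ∃ θ : ℝ, θ < 1 - (1 / 2 : ℝ) ^ (n / 3 + 1) ∧ ∀ f g : (Fin n → Bool) → Bool, IsDegLeFun 3 f → IsDegLeFun 3 g →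
      θ < forrelation f g → forrelation f g = 1 :=
  fb_theta_lt_of_closed (n := n) _ (isolation_rate_closed_two_mod_six n hn h14)

end Summit.QuantumAdvantage.QuantumAdvantage.Theorems.CubicForrelation.NearExactIsExact

end
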